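import Summits.BirchSwinnertonDyer.BirchSwinnertonDyer.Theorems.PrintCf2DisegniPairTwoFrameCurves
import Summits.BirchSwinnertonDyer.BirchSwinnertonDyer.Theorems.PrintCf2DisegniPairTwoCompanionValueChi8
import Summits.BirchSwinnertonDyer.BirchSwinnertonDyer.Theorems.PrintCf2DisegniPairTwoCompanionValueChi4
import Summits.BirchSwinnertonDyer.BirchSwinnertonDyer.Theorems.PrintCf2DisegniPairTwoCompanionValueChi8Prime
import Summits.BirchSwinnertonDyer.BirchSwinnertonDyer.Theorems.PrintCf2DisegniPairTwoPeriodRatios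
import Literature.NumberTheory.EllipticCurves.PadicSigmaSqMinusTwistBoundaryProofs
import Literature.NumberTheory.EllipticCurves.PAdicLFunctionZeroAtMinusTwoProofs
import Literature.NumberTheory.EllipticCurves.PAdicLFunctionMinusConstantTermAtTwoProofs
import Literature.NumberTheory.EllipticCurves.PAdicBSDMemIwasawaRatProofs
import HarnessLib

/-!
# Road (C) `disegni-pair-two` on crux stmt-BirchSwinnertonDyer-20368 — FRAME, the three branch-point vanishings `h0`

LEAD `bsd-line-cf2-p1` g21, for the registered stub `stub_frame_two` of `Lines/disegni_pair_two.lean` (v3). The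
class-specific `h0` clauses of the frame: on the `χ₈∘N`-line `L₂(f_V, α_V)(−2) = 0`, on the `χ₋₄∘N`-line the constant term
of the odd branch vanishes, on the `χ₋₈∘N`-line `Σ_k [T^k]L₂⁻(f_V, α_V, ω)(−2)^k = 0` — each from the Mazur–Tate–Teitelbaum
interpolation at the corresponding conductor-`8`/`4` character and `L(W,1) = 0` via Birch's formula (tree
`hasSum_coeff_padicLFunction_two_neg_two_zero`, `constantCoeff_padicLFunctionMinusBranch_one_two_of_coeffField`, -w8 g21's
`algebraMap_tsum_coeff_padicLFunctionMinusBranch_neg_two`, `ratMinusTwistedSymbolSum_chi4/chi8'_mul_minusPeriod_eq`); and the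
three sign characters `χ₈, χ₋₄, χ₋₈` read as Jacobi symbols on `ℕ`. THEOREMS ONLY; no `sorry`; no new definitions. BSD is
not proved by any of this; 20368 is not closed here.
-/

set_option linter.dupNamespace false

noncomputable section

open scoped Classical MatrixGroups ModularForm NumberField NumberTheorySymbols

open CongruenceSubgroup NumberField IsDedekindDomain WeierstrassCurve WeierstrassCurve.Affine.Point
  Literature.NumberTheory.EllipticCurves Literature.NumberTheory.EllipticCurves.ModularForms
  Literature.NumberTheory.EllipticCurves.Disegni2017 Literature.NumberTheory.GaloisRepresentations
  Summit.BirchSwinnertonDyer.Rank1Residual.AdditivePotMult Summit.BirchSwinnertonDyer.Rank1Residual.Additive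

namespace Summit.BirchSwinnertonDyer.BirchSwinnertonDyer.Theorems.PrintCf2.DisegniPairTwo

/-! ### §1 The three sign characters `χ₈, χ₋₄, χ₋₈` as Jacobi symbols on `ℕ` -/

/-- `χ₈(m) = (2/m)` for odd `m`, `0` for even `m`. [folklore] -/
theorem chi8_ringHomComp_natCast (m : ℕ) :
    (ZMod.χ₈.ringHomComp (Int.castRingHom ℂ)) m = (((if Even m then 0 else J(2 | m) : ℤ)) : ℂ) := by
  rw [MulChar.ringHomComp_apply, Int.coe_castRingHom]
  congr 1
  by_cases hm : Even m
  · rw [if_pos hm, ZMod.χ₈_nat_eq_if_mod_eight, if_pos (Nat.even_iff.mp hm)]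
  · rw [if_neg hm, jacobiSym.at_two (Nat.not_even_iff_odd.mp hm)]

/-- `χ₋₄(m) = (−1/m)` for odd `m`, `0` for even `m`. [folklore] -/
theorem chi4_ringHomComp_natCast (m : ℕ) :
    (ZMod.χ₄.ringHomComp (Int.castRingHom ℂ)) m = (((if Even m then 0 else J(-1 | m) : ℤ)) : ℂ) := by
  rw [MulChar.ringHomComp_apply, Int.coe_castRingHom]
  congr 1
  by_cases hm : Even m
  · rw [if_pos hm, ZMod.χ₄_nat_eq_if_mod_four, if_pos (Nat.even_iff.mp hm)]
  · rw [if_neg hm, jacobiSym.at_neg_one (Nat.not_even_iff_odd.mp hm)]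

/-- `χ₋₈(m) = (−2/m)` for odd `m`, `0` for even `m`. [folklore] -/
theorem chi8'_ringHomComp_natCast (m : ℕ) :
    (ZMod.χ₈'.ringHomComp (Int.castRingHom ℂ)) m = (((if Even m then 0 else J(-2 | m) : ℤ)) : ℂ) := by
  rw [MulChar.ringHomComp_apply, Int.coe_castRingHom]
  congr 1
  by_cases hm : Even m
  · rw [if_pos hm, ZMod.χ₈'_nat_eq_if_mod_eight, if_pos (Nat.even_iff.mp hm)]
  · rw [if_neg hm, jacobiSym.at_neg_two (Nat.not_even_iff_odd.mp hm)]

/-! ### §2 The three branch-point vanishings `h0` -/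

/-- **`h0` on the `χ₈∘N`-line: `L₂(f_V, α_V)(−2) = 0`** when the member `W ≅ V^{(2)}` has `L(W,1) = 0` (`r_an = 1`):
MTT interpolation at `χ₈` (tree `hasSum_coeff_padicLFunction_two_neg_two_zero`), pulled back from `ℂ₂` to `ℚ₂`.
[cite: MazurTateTeitelbaum1986Invent, §I.14 Proposition (p. 20)] -/
theorem hasSum_padicLFunction_neg_two_zero_of_member (V W : WeierstrassCurve ℚ) [V.IsElliptic] [V.IsGloballyMinimal]
    [W.IsElliptic] (hordV : IsOrdinaryAt V 2) {N : ℕ} [NeZero N] {f : CuspForm (Gamma0 N) 2} (hf : IsNewformOf V f)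
    [(V.quadraticTwist 2).IsElliptic] {C : VariableChange ℚ} (hC : C • W = V.quadraticTwist 2) (hr : W.analyticRank = 1) :
    HasSum (fun k : ℕ ↦ PowerSeries.coeff k (padicLFunction f (unitRoot V 2 : ℚ_[2])) * (-2 : ℚ_[2]) ^ k) 0 := by
  have hr2 : (V.quadraticTwist 2).analyticRank ≠ 0 := by
    have e : (V.quadraticTwist 2).analyticRank = W.analyticRank := by rw [← hC]; exact analyticRank_smul W C
    rw [e, hr]; exact one_ne_zero
  have h := hasSum_coeff_padicLFunction_two_neg_two_zero hordV hf hr2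
  obtain ⟨Cb, hCb⟩ := exists_forall_norm_coeff_padicLFunction_le (f := f) hordV hf
  have hS := summable_coeff_mul_pow_of_norm_le hCb
    (show ‖(-2 : ℚ_[2])‖ < 1 by
      rw [norm_neg, show (2 : ℚ_[2]) = ((2 : ℕ) : ℚ_[2]) by norm_num, Padic.norm_p]; norm_num)
  have h1 := hS.hasSum.map (algebraMap ℚ_[2] ℂ_[2]) (continuous_algebraMap ℚ_[2] ℂ_[2])
  have hfun : (fun k : ℕ ↦ algebraMap ℚ_[2] ℂ_[2]
      (PowerSeries.coeff k (padicLFunction f (unitRoot V 2 : ℚ_[2]))) * (-2) ^ k) =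
      (algebraMap ℚ_[2] ℂ_[2]) ∘ (fun k : ℕ ↦ PowerSeries.coeff k (padicLFunction f (unitRoot V 2 : ℚ_[2])) *
        (-2) ^ k) := by
    funext k
    simp only [Function.comp_apply, map_mul, map_pow, map_neg, map_ofNat]
  rw [hfun] at h
  have heq : algebraMap ℚ_[2] ℂ_[2]
      (∑' k : ℕ, PowerSeries.coeff k (padicLFunction f (unitRoot V 2 : ℚ_[2])) * (-2) ^ k) = 0 := h1.unique h
  have htsum : (∑' k : ℕ, PowerSeries.coeff k (padicLFunction f (unitRoot V 2 : ℚ_[2])) * (-2) ^ k) = 0 :=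
    (algebraMap ℚ_[2] ℂ_[2]).injective (by rw [heq, _root_.map_zero])
  exact hS.hasSum_iff.mpr htsum

/-- **`h0` on the `χ₋₄∘N`-line: the constant term of the odd branch `L₂⁻(f_V, α_V, ω, 0) = 0`** when the member
`W` (newform `g = f ⊗ χ₋₄`) has `L(W,1) = 0`: `L₂⁻(0) = α⁻²([1/4]⁻ − [3/4]⁻)` and Birch's odd formula
`S₄⁻(f)·Ω⁻_f·i = τ(χ₋₄)·L(W,1)`. [cite: MazurTateTeitelbaum1986Invent, §I.8 (8.6) and §I.13] -/
theorem constantCoeff_padicLFunctionMinusBranch_zero_of_member (hmod : hasEntireLFunction_rat)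
    (V W : WeierstrassCurve ℚ) [V.IsElliptic] [V.IsGloballyMinimal] [W.IsElliptic] (hordV : IsOrdinaryAt V 2)
    {N M : ℕ} [NeZero N] [NeZero M] {f : CuspForm (Gamma0 N) 2} {g : CuspForm (Gamma0 M) 2} (hf : IsNewformOf V f)
    (hg : IsNewformOf W g)
    (hgε : ∀ m : ℕ, cuspCoeff g m = (ZMod.χ₄.ringHomComp (Int.castRingHom ℂ)) m * cuspCoeff f m)
    (hL0 : W.entireLFunction 1 = 0) :
    PowerSeries.constantCoeff (padicLFunctionMinusBranch f (unitRoot V 2 : ℚ_[2]) 1) = 0 := by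
  obtain ⟨hαeq, -, hα0⟩ := unitRoot_coe_spec (W := V) hordV
  have hN2 : ¬ 2 ∣ N := not_dvd_level_of_isNewformOf hf hordV.1
  have hapf : cuspCoeff f 2 = ((V.frobeniusTrace 2 : ℤ) : ℂ) := cuspCoeff_eq_frobeniusTrace_of_isNewformOf_holds hf hordV.1
  rw [constantCoeff_padicLFunctionMinusBranch_one_two_of_coeffField f hf.1 hf.coeffField_eq_bot hN2 hapf hα0
    (by exact_mod_cast hαeq)]
  have hB := ratMinusTwistedSymbolSum_chi4_mul_minusPeriod_eq hmod hf.1 hf.coeffField_eq_bot W hg hgε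
  rw [hL0, mul_zero] at hB
  have hΩ : (minusPeriod f : ℂ) ≠ 0 := by
    exact_mod_cast (IsNewform0.minusPeriod_pos_holds hf.1 hf.coeffField_eq_bot).ne'
  have hS : ratMinusTwistedSymbolSum f
      (haveI : NeZero (2 ^ 2) := ⟨by norm_num⟩
       (ZMod.χ₄.ringHomComp (Int.castRingHom ℂ) : DirichletCharacter ℂ (2 ^ 2))) = 0 := by
    rcases mul_eq_zero.mp hB with h | h
    · rcases mul_eq_zero.mp h with h' | h'
      · exact h'
      · exact absurd h' hΩ
    · exact absurd h Complex.I_ne_zero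
  rw [ratMinusTwistedSymbolSum_chi4_eq f] at hS
  have hq : (ratMinusSymbol f (1 / 4) - ratMinusSymbol f (3 / 4) : ℚ) = 0 := by exact_mod_cast hS
  have hq2 : ((ratMinusSymbol f (1 / 4) : ℚ_[2]) - (ratMinusSymbol f (3 / 4) : ℚ_[2])) = 0 := by
    rw [← Rat.cast_sub, hq, Rat.cast_zero]
  rw [hq2, mul_zero]

/-- **`h0` on the `χ₋₈∘N`-line: `Σ_k [T^k]L₂⁻(f_V, α_V, ω)·(−2)^k = 0`** when the member `W` (newform `g = f ⊗ χ₋₈`) has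
`L(W,1) = 0`: MTT interpolation of the odd branch at the twin of `χ₈` (-w8 g21) and Birch's odd formula at `χ₋₈`.
[cite: MazurTateTeitelbaum1986Invent, §I.8 (8.6) and §I.13–I.14] -/
theorem hasSum_padicLFunctionMinusBranch_neg_two_zero_of_member (hmod : hasEntireLFunction_rat)
    (V W : WeierstrassCurve ℚ) [V.IsElliptic] [V.IsGloballyMinimal] [W.IsElliptic] (hordV : IsOrdinaryAt V 2)
    {N M : ℕ} [NeZero N] [NeZero M] {f : CuspForm (Gamma0 N) 2} {g : CuspForm (Gamma0 M) 2} (hf : IsNewformOf V f)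
    (hg : IsNewformOf W g)
    (hgε : ∀ m : ℕ, cuspCoeff g m = (ZMod.χ₈'.ringHomComp (Int.castRingHom ℂ)) m * cuspCoeff f m)
    (hL0 : W.entireLFunction 1 = 0) :
    HasSum (fun k : ℕ ↦ PowerSeries.coeff k (padicLFunctionMinusBranch f (unitRoot V 2 : ℚ_[2]) 1) *
      (-2 : ℚ_[2]) ^ k) 0 := by
  obtain ⟨ι⟩ := PadicAlgCl.nonempty_ringEquiv_complex 2
  obtain ⟨hαeq, hαu, hα0⟩ := unitRoot_coe_spec (W := V) hordV
  set α : ℚ_[2] := (unitRoot V 2 : ℚ_[2]) with hαdef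
  have hN2 : ¬ 2 ∣ N := not_dvd_level_of_isNewformOf hf hordV.1
  have hapf : cuspCoeff f 2 = ((V.frobeniusTrace 2 : ℤ) : ℂ) := cuspCoeff_eq_frobeniusTrace_of_isNewformOf_holds hf hordV.1
  -- summability of the odd branch at `−2` (bounded coefficients)
  have hdist := fun n a ↦
    sum_fiber_msdMinusMeasure_succ_eq_of_coeffField (p := 2) hf.1 hf.coeffField_eq_bot hN2 hapf hα0 hαeq n a
  obtain ⟨C', hC'⟩ := exists_norm_msdMinusMeasure_le_of_maninDrinfeld (p := 2)
    (exists_nsmul_modularSymbol_mem_periodLattice_of_isNewform0 hf.1 hf.coeffField_eq_bot) hαu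
  have hCb : ∀ k, ‖PowerSeries.coeff k (padicLFunctionMinusBranch f α 1)‖ ≤ C' :=
    norm_coeff_padicLFunctionMinusBranch_le f α hdist hC' 1
  have hS := summable_coeff_mul_pow_of_norm_le hCb
    (show ‖(-2 : ℚ_[2])‖ < 1 by
      rw [norm_neg, show (2 : ℚ_[2]) = ((2 : ℕ) : ℚ_[2]) by norm_num, Padic.norm_p]; norm_num)
  -- the value: Birch's odd formula at `χ₋₈` and `L(W,1) = 0`
  have hA := algebraMap_tsum_coeff_padicLFunctionMinusBranch_neg_two ι hordV hf
  have hB := ratMinusTwistedSymbolSum_chi8'_mul_minusPeriod_eq hmod hf.1 hf.coeffField_eq_bot W hg hgε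
  rw [hL0, mul_zero] at hB
  have hΩ : (minusPeriod f : ℂ) ≠ 0 := by
    exact_mod_cast (IsNewform0.minusPeriod_pos_holds hf.1 hf.coeffField_eq_bot).ne'
  have hSum : ratMinusTwistedSymbolSum f
      (haveI : NeZero (2 ^ (2 + 1)) := ⟨by norm_num⟩
       (ZMod.χ₈'.ringHomComp (Int.castRingHom ℂ) : DirichletCharacter ℂ (2 ^ (2 + 1)))) = 0 := by
    rcases mul_eq_zero.mp hB with h | h
    · rcases mul_eq_zero.mp h with h' | h'
      · exact h'
      · exact absurd h' hΩ
    · exact absurd h Complex.I_ne_zero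
  rw [hSum, _root_.map_zero, PadicComplex.coe_eq, _root_.map_zero, mul_zero] at hA
  have htsum : (∑' k : ℕ, PowerSeries.coeff k (padicLFunctionMinusBranch f α 1) * (-2) ^ k) = 0 :=
    (algebraMap ℚ_[2] ℂ_[2]).injective (by rw [hA, _root_.map_zero])
  exact hS.hasSum_iff.mpr htsum

end Summit.BirchSwinnertonDyer.BirchSwinnertonDyer.Theorems.PrintCf2.DisegniPairTwo

end
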